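import Mathlib.RingTheory.Ideal.Operations
import Mathlib.RingTheory.Ideal.Span
import Mathlib.Algebra.Polynomial.Degree.Defs
import Mathlib.Order.Interval.Finset.Nat
import Mathlib.Data.EReal.Basic
import Mathlib.Analysis.Convex.Basic
import HarnessLib

/-!
# Cossart–Piltant 2019, Ch. 2: monomial valuations and the polyhedron `Δ_S(h; u; X)`

Topic: `Literature/AlgebraicGeometry/Resolution`. DEFINITIONS (with small API) from the opening
of Ch. 2 "Adapted structure and primary invariants" of Cossart–Piltant, *Resolution of
singularities of arithmetical threefolds* (arXiv v1 pp. 9–10), needed to state anything of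
§§2.1–2.8 (and hence the `m(x) = p` branch `Heq` of
`CossartPiltant2019Local.of_normalForm_cases`, `ArithmeticalThreefoldsLocalReduction.lean`).
Setting: a commutative ring `S` (in the paper a regular local ring), a family
`u = (u₁, …, u_n)` of elements (an r.s.p.), a weight vector `α ∈ ℝⁿ_{≥ 0}`, and a monic
`h = X^m + f_{1,X} X^{m-1} + ⋯ + f_{m,X} ∈ S[X]` (so `f_{i,X} = coeff_{m-i} h`).

> (v1 p. 9) "For `x ∈ ℝⁿ_{≥0}`, denote `|x|_α := α₁x₁ + ⋯ + α_n x_n`. An associated valuation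
> `μ_α` of `K` is defined by setting for `f ∈ S`, `f ≠ 0`:
> `μ_α(f) := max{a ∈ Γ_α : f ∈ I_α(a) := ({u₁^{x₁} ⋯ u_n^{x_n} : |x|_α ≥ a})}`. …
> Note that `ord_{m_S} = μ_𝟙`."
> (v1 p. 10, Def. 2.1) "`Δ_S(h; u; X) := Conv(⋃_{i=1}^m ⋃_{a ∈ S(f_{i,X})} {a/i + ℝⁿ_{≥0}}) ⊆ ℝⁿ_{≥0}`."
> (Def. 2.2) "`δ_α(h; u; X) := min{|x|_α : x ∈ Δ_S(h; u; X)}`."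

## Content (namespace `Literature.AlgebraicGeometry.Resolution.CossartPiltant`)

* `weight α x = |x|_α`, `uPow u x = u^x = ∏ u_j^{x_j}`;
* `monomialIdeal u α a = I_α(a)`, the ideal generated by the monomials `u^x` with `|x|_α ≥ a`;
* `monomialVal u α f = μ_α(f) := sup{a : f ∈ I_α(a)} ∈ EReal` (`⊤` for `f = 0`; the paper's
  `max` over `Γ_α` — attained by Noetherianity — has the same value);
* `DeltaGE u α h q` — "`δ_α(h; u; X) ≥ q`", i.e. `f_{i,X} ∈ I_α(i q)` for `1 ≤ i ≤ m`, and
  `delta u α h = δ_α(h; u; X) := sup{q : DeltaGE u α h q}`;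
* `charPolyhedron u h = Δ_S(h; u; X)`, RENDERED as the closed convex up-set
  `{x ∈ ℝⁿ_{≥0} : |x|_α ≥ q whenever δ_α ≥ q, for all weights α > 0}`.

Rendering note (faithfulness). Def. 2.1 builds `Δ` from the exponent sets `S(f_{i,X})` of the
monomial expansions of Prop. 2.1 (which needs `S` regular and the `u` an r.s.p.); Def. 2.2 then
reads `δ_α` off `Δ`. We take the dual route, which needs no expansion: `δ_α` is defined directly
by ideal membership — by Prop. 2.1 (ii) (`γ(f, a) ∉ I_J`) one has `μ_α(f) = min_{a ∈ S(f)} |a|_α`,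
so `δ_α = min_i μ_α(f_{i,X})/i = sup{q : ∀ i, f_{i,X} ∈ I_α(iq)}` agrees with Def. 2.2 — and `Δ`
is recovered from its support function `α ↦ δ_α` (a closed convex subset of `ℝⁿ_{≥0}` stable
under `+ ℝⁿ_{≥0}` is the intersection of the half-spaces `|x|_α ≥ δ_α`, `α > 0`). These two
identifications are NOT proved here; everything below is about the rendered objects.

API proved: antitonicity of `I_α(a)` in `a` and `I_α(a) = S` for `a ≤ 0`; `u^x ∈ I_α(|x|_α)`;
`DeltaGE` is antitone and holds for `q ≤ 0`; `Δ` is convex and an up-set; and the link with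
multiplicity used throughout the paper: for `α = 𝟙` and `(u) = 𝔪`,
**`I_𝟙(k) = 𝔪ᵏ`** (`monomialIdeal_one_natCast`) and hence
**`δ_𝟙(h; u; X) ≥ 1 ⟺ f_{i,X} ∈ 𝔪ⁱ (1 ≤ i ≤ m)`** (`deltaGE_one_one_iff`) — which by
`Polynomial.mem_sup_span_X_sub_C_pow_natDegree_iff` (`ArithmeticalThreefoldsLocalProofs.lean`) is
`ord_{(𝔪, X)} h ≥ m`, i.e. "`x = (m_S, X) ∈ Sing_m 𝒳`" (cf. Prop. 2.3 (ii), v1 p. 11).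

## Sources

* V. Cossart, O. Piltant, *Resolution of singularities of arithmetical threefolds*, J. Algebra
  529 (2019) 268–535 = arXiv:1412.0868, Ch. 2 (arXiv v1 p. 9: `|x|_α`, `I_α(a)`, `μ_α`;
  p. 10: Prop. 2.1, Def. 2.1, Def. 2.2, Remark 2.1; p. 11: Prop. 2.3). [CossartPiltant2019]
* H. Hironaka, *Characteristic polyhedra of singularities*, J. Math. Kyoto Univ. 7 (1967)
  ([H3] of the paper; the general notion).
-/

noncomputable section

open Polynomial Finset

namespace Literature.AlgebraicGeometry.Resolution.CossartPiltant

universe u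

variable {S : Type u} [CommRing S] {n : ℕ}

/-! ## Weights and monomials -/

/-- `|x|_α := α₁ x₁ + ⋯ + α_n x_n` for a weight vector `α` and an exponent vector `x`
(Cossart–Piltant 2019, v1 p. 9). [cite: CossartPiltant2019, Ch. 2 (arXiv v1 p. 9)] -/
def weight (α : Fin n → ℝ) (x : Fin n → ℕ) : ℝ := ∑ j, α j * x j

/-- The monomial `u^x := ∏_j u_j^{x_j}` in the elements `u₁, …, u_n` of `S`
(Cossart–Piltant 2019, v1 p. 9). [cite: CossartPiltant2019, Ch. 2 (arXiv v1 p. 9)] -/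
def uPow (u : Fin n → S) (x : Fin n → ℕ) : S := ∏ j, u j ^ x j

/-- `|·|_α` is additive. [folklore] -/
theorem weight_add (α : Fin n → ℝ) (x y : Fin n → ℕ) :
    weight α (x + y) = weight α x + weight α y := by
  simp only [weight, Pi.add_apply, Nat.cast_add, mul_add, Finset.sum_add_distrib]

/-- `|0|_α = 0`. [folklore] -/
@[simp] theorem weight_zero (α : Fin n → ℝ) : weight α 0 = 0 := by
  simp [weight]

/-- `|·|_α ≥ 0` for `α ≥ 0`. [folklore] -/
theorem weight_nonneg {α : Fin n → ℝ} (hα : ∀ j, 0 ≤ α j) (x : Fin n → ℕ) : 0 ≤ weight α x :=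
  Finset.sum_nonneg fun j _ => mul_nonneg (hα j) (Nat.cast_nonneg _)

/-- `|x|_𝟙 = Σ x_j`. [folklore] -/
theorem weight_one (x : Fin n → ℕ) : weight (fun _ => (1 : ℝ)) x = ∑ j, (x j : ℝ) := by
  simp [weight]

/-- `|e_j|_α = α_j`. [folklore] -/
theorem weight_single (α : Fin n → ℝ) (j : Fin n) : weight α (Pi.single j 1) = α j := by
  rw [weight, Finset.sum_eq_single j]
  · simp
  · intro i _ hij
    simp [hij]
  · intro hj
    exact absurd (Finset.mem_univ j) hj

/-- `u^{x+y} = u^x u^y`. [folklore] -/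
theorem uPow_add (u : Fin n → S) (x y : Fin n → ℕ) : uPow u (x + y) = uPow u x * uPow u y := by
  simp only [uPow, Pi.add_apply, pow_add, Finset.prod_mul_distrib]

/-- `u^0 = 1`. [folklore] -/
@[simp] theorem uPow_zero (u : Fin n → S) : uPow u 0 = 1 := by
  simp [uPow]

/-- `u^{e_i} = u_i`. [folklore] -/
theorem uPow_single (u : Fin n → S) (i : Fin n) : uPow u (Pi.single i 1) = u i := by
  rw [uPow, Finset.prod_eq_single i]
  · simp
  · intro j _ hji
    simp [hji]
  · intro hi
    exact absurd (Finset.mem_univ i) hi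

/-! ## The monomial filtration `I_α(a)` and the monomial valuation `μ_α` -/

/-- **`I_α(a)`** — the ideal of `S` generated by the monomials `u^x` of weight `|x|_α ≥ a`
(Cossart–Piltant 2019, v1 p. 9: "`I_α(a) := ({u₁^{x₁} ⋯ u_n^{x_n} : |x|_α ≥ a})`").
[cite: CossartPiltant2019, Ch. 2 (arXiv v1 p. 9)] -/
def monomialIdeal (u : Fin n → S) (α : Fin n → ℝ) (a : ℝ) : Ideal S :=
  Ideal.span {m | ∃ x : Fin n → ℕ, a ≤ weight α x ∧ m = uPow u x}

/-- A monomial of weight `≥ a` lies in `I_α(a)`. [cite: CossartPiltant2019, Ch. 2 (arXiv v1 p. 9)] -/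
theorem uPow_mem_monomialIdeal (u : Fin n → S) {α : Fin n → ℝ} {a : ℝ} {x : Fin n → ℕ}
    (hx : a ≤ weight α x) : uPow u x ∈ monomialIdeal u α a :=
  Ideal.subset_span ⟨x, hx, rfl⟩

/-- `I_α(·)` is a decreasing filtration: `a ≤ b ⇒ I_α(b) ⊆ I_α(a)`.
[cite: CossartPiltant2019, Ch. 2 (arXiv v1 p. 9)] -/
theorem monomialIdeal_antitone (u : Fin n → S) (α : Fin n → ℝ) :
    Antitone (monomialIdeal u α) := by
  intro a b hab
  apply Ideal.span_mono
  rintro m ⟨x, hx, rfl⟩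
  exact ⟨x, hab.trans hx, rfl⟩

/-- `I_α(a) = S` for `a ≤ 0` (the empty monomial `u^0 = 1` has weight `0`).
[cite: CossartPiltant2019, Ch. 2 (arXiv v1 p. 9)] -/
theorem monomialIdeal_of_nonpos (u : Fin n → S) (α : Fin n → ℝ) {a : ℝ} (ha : a ≤ 0) :
    monomialIdeal u α a = ⊤ := by
  rw [eq_top_iff, ← Ideal.span_singleton_one, Ideal.span_le, Set.singleton_subset_iff]
  exact uPow_zero u ▸ uPow_mem_monomialIdeal u (x := 0) (by simpa using ha)

/-- `I_α(a) I_α(b) ⊆ I_α(a + b)` (`|x + y|_α = |x|_α + |y|_α`). [cite: CossartPiltant2019, Ch. 2 (arXiv v1 p. 9)] -/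
theorem monomialIdeal_mul_le (u : Fin n → S) (α : Fin n → ℝ) (a b : ℝ) :
    monomialIdeal u α a * monomialIdeal u α b ≤ monomialIdeal u α (a + b) := by
  rw [monomialIdeal, monomialIdeal, Ideal.span_mul_span']
  apply Ideal.span_le.mpr
  rintro _ ⟨m, ⟨x, hx, rfl⟩, m', ⟨y, hy, rfl⟩, rfl⟩
  show uPow u x * uPow u y ∈ monomialIdeal u α (a + b)
  rw [← uPow_add]
  refine uPow_mem_monomialIdeal u ?_
  rw [weight_add]
  exact add_le_add hx hy

/-- **`μ_α(f)`** — the monomial valuation of `f ∈ S` with respect to `(u, α)`: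
`sup{a : f ∈ I_α(a)}`, valued in `EReal` (`⊤` for `f = 0`, `≥ 0` always). The paper (v1 p. 9)
takes the `max` over the discrete group `Γ_α`, which is attained for `S` Noetherian and has the
same value. `ord_{m_S} = μ_𝟙` when `u` is an r.s.p. (`monomialIdeal_one_natCast`).
[cite: CossartPiltant2019, Ch. 2 (arXiv v1 p. 9)] -/
def monomialVal (u : Fin n → S) (α : Fin n → ℝ) (f : S) : EReal :=
  sSup {r : EReal | ∃ a : ℝ, f ∈ monomialIdeal u α a ∧ r = a}

/-- `μ_α(f) ≥ a` as soon as `f ∈ I_α(a)`. [cite: CossartPiltant2019, Ch. 2 (arXiv v1 p. 9)] -/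
theorem le_monomialVal_of_mem {u : Fin n → S} {α : Fin n → ℝ} {f : S} {a : ℝ}
    (h : f ∈ monomialIdeal u α a) : (a : EReal) ≤ monomialVal u α f :=
  le_sSup ⟨a, h, rfl⟩

/-- `μ_α(f) ≥ 0`. [cite: CossartPiltant2019, Ch. 2 (arXiv v1 p. 9)] -/
theorem monomialVal_nonneg (u : Fin n → S) (α : Fin n → ℝ) (f : S) : 0 ≤ monomialVal u α f :=
  le_monomialVal_of_mem (by rw [monomialIdeal_of_nonpos u α le_rfl]; exact Submodule.mem_top)

/-- `μ_α(0) = ⊤`. [cite: CossartPiltant2019, Ch. 2 (arXiv v1 p. 9)] -/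
theorem monomialVal_zero (u : Fin n → S) (α : Fin n → ℝ) : monomialVal u α 0 = ⊤ := by
  rw [monomialVal, sSup_eq_top]
  intro b hb
  induction b using EReal.rec with
  | bot => exact ⟨0, ⟨0, Ideal.zero_mem _, by simp⟩, EReal.bot_lt_coe 0⟩
  | coe r => exact ⟨(r + 1 : ℝ), ⟨r + 1, Ideal.zero_mem _, rfl⟩, by exact_mod_cast lt_add_one r⟩
  | top => exact absurd hb (lt_irrefl _)

/-! ## `δ_α(h; u; X)` and the polyhedron `Δ_S(h; u; X)` -/

/-- **"`δ_α(h; u; X) ≥ q`"**: `f_{i,X} ∈ I_α(i q)` for `1 ≤ i ≤ m = deg h`, where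
`f_{i,X} = coeff_{m-i} h` (Cossart–Piltant 2019, v1 p. 10, Def. 2.2 with Prop. 2.1:
`δ_α = min_i μ_α(f_{i,X})/i`). [cite: CossartPiltant2019, Def. 2.2 (arXiv v1 p. 10)] -/
def DeltaGE (u : Fin n → S) (α : Fin n → ℝ) (h : S[X]) (q : ℝ) : Prop :=
  ∀ i ∈ Finset.Icc 1 h.natDegree, h.coeff (h.natDegree - i) ∈ monomialIdeal u α (i * q)

/-- **`δ_α(h; u; X)`** `:= sup{q : δ_α ≥ q} = min_{1 ≤ i ≤ m} μ_α(f_{i,X})/i ∈ EReal`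
(Cossart–Piltant 2019, v1 p. 10, Def. 2.2, in the rendering explained in the module docstring;
`⊤` iff all `f_{i,X} = 0`, i.e. `h = X^m`, cf. Remark 2.1 "`Δ = ∅ ⟺ h = X^m`").
[cite: CossartPiltant2019, Def. 2.2 (arXiv v1 p. 10)] -/
def delta (u : Fin n → S) (α : Fin n → ℝ) (h : S[X]) : EReal :=
  sSup {r : EReal | ∃ q : ℝ, DeltaGE u α h q ∧ r = q}

/-- **`Δ_S(h; u; X)`**, rendered by its support function: the set of `x ∈ ℝⁿ_{≥0}` with
`|x|_α ≥ q` for every weight vector `α > 0` and every `q` with `δ_α(h; u; X) ≥ q`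
(Cossart–Piltant 2019, v1 p. 10, Def. 2.1 defines it as
`Conv(⋃_i ⋃_{a ∈ S(f_{i,X})} (a/i + ℝⁿ_{≥0}))`; see the module docstring for the identification).
[cite: CossartPiltant2019, Def. 2.1 (arXiv v1 p. 10)] -/
def charPolyhedron (u : Fin n → S) (h : S[X]) : Set (Fin n → ℝ) :=
  {x | (∀ j, 0 ≤ x j) ∧ ∀ α : Fin n → ℝ, (∀ j, 0 < α j) → ∀ q : ℝ, DeltaGE u α h q →
    q ≤ ∑ j, α j * x j}

/-- `δ_α ≥ q` is antitone in `q`. [cite: CossartPiltant2019, Def. 2.2 (arXiv v1 p. 10)] -/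
theorem DeltaGE.anti {u : Fin n → S} {α : Fin n → ℝ} {h : S[X]} {q q' : ℝ} (hq : q' ≤ q)
    (H : DeltaGE u α h q) : DeltaGE u α h q' := fun i hi =>
  monomialIdeal_antitone u α (mul_le_mul_of_nonneg_left hq (Nat.cast_nonneg i)) (H i hi)

/-- `δ_α ≥ q` holds for `q ≤ 0`. [cite: CossartPiltant2019, Def. 2.2 (arXiv v1 p. 10)] -/
theorem DeltaGE.of_nonpos (u : Fin n → S) (α : Fin n → ℝ) (h : S[X]) {q : ℝ} (hq : q ≤ 0) :
    DeltaGE u α h q := fun i _ => by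
  rw [monomialIdeal_of_nonpos u α (mul_nonpos_of_nonneg_of_nonpos (Nat.cast_nonneg i) hq)]
  exact Submodule.mem_top

/-- `δ_α ≥ q ⇒ (q : EReal) ≤ δ_α(h; u; X)`. [cite: CossartPiltant2019, Def. 2.2 (arXiv v1 p. 10)] -/
theorem DeltaGE.le_delta {u : Fin n → S} {α : Fin n → ℝ} {h : S[X]} {q : ℝ}
    (H : DeltaGE u α h q) : (q : EReal) ≤ delta u α h :=
  le_sSup ⟨q, H, rfl⟩

/-- `δ_α(h; u; X) ≥ 0`. [cite: CossartPiltant2019, Def. 2.2 (arXiv v1 p. 10)] -/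
theorem delta_nonneg (u : Fin n → S) (α : Fin n → ℝ) (h : S[X]) : 0 ≤ delta u α h :=
  (DeltaGE.of_nonpos u α h le_rfl).le_delta

/-- `Δ_S(h; u; X)` is an up-set of `ℝⁿ_{≥0}`: `x ∈ Δ`, `x ≤ y ⇒ y ∈ Δ` (it is stable under
`+ ℝⁿ_{≥0}`). [cite: CossartPiltant2019, Def. 2.1 (arXiv v1 p. 10)] -/
theorem mem_charPolyhedron_of_le {u : Fin n → S} {h : S[X]} {x y : Fin n → ℝ}
    (hx : x ∈ charPolyhedron u h) (hxy : x ≤ y) : y ∈ charPolyhedron u h := by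
  refine ⟨fun j => (hx.1 j).trans (hxy j), fun α hα q hq => (hx.2 α hα q hq).trans ?_⟩
  exact Finset.sum_le_sum fun j _ => mul_le_mul_of_nonneg_left (hxy j) (hα j).le

/-- `Δ_S(h; u; X)` is convex. [cite: CossartPiltant2019, Def. 2.1 (arXiv v1 p. 10)] -/
theorem convex_charPolyhedron (u : Fin n → S) (h : S[X]) : Convex ℝ (charPolyhedron u h) := by
  intro x hx y hy a b ha hb hab
  refine ⟨fun j => ?_, fun α hα q hq => ?_⟩
  · simp only [Pi.add_apply, Pi.smul_apply, smul_eq_mul]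
    exact add_nonneg (mul_nonneg ha (hx.1 j)) (mul_nonneg hb (hy.1 j))
  · have h1 := hx.2 α hα q hq
    have h2 := hy.2 α hα q hq
    calc q = a * q + b * q := by rw [← add_mul, hab, one_mul]
      _ ≤ a * ∑ j, α j * x j + b * ∑ j, α j * y j :=
          add_le_add (mul_le_mul_of_nonneg_left h1 ha) (mul_le_mul_of_nonneg_left h2 hb)
      _ = ∑ j, α j * (a • x + b • y) j := by
          simp only [Finset.mul_sum, Pi.add_apply, Pi.smul_apply, smul_eq_mul,
            ← Finset.sum_add_distrib]
          refine Finset.sum_congr rfl fun j _ => ?_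
          ring

/-! ## `α = 𝟙`: `I_𝟙(k) = 𝔪ᵏ` and `δ_𝟙 ≥ 1 ⟺ f_{i,X} ∈ 𝔪ⁱ` -/

/-- Monomials of total degree `≥ k` lie in `(u)ᵏ`. [folklore] -/
theorem uPow_mem_span_pow (u : Fin n → S) {x : Fin n → ℕ} {k : ℕ} (hk : k ≤ ∑ j, x j) :
    uPow u x ∈ Ideal.span (Set.range u) ^ k := by
  have : uPow u x ∈ Ideal.span (Set.range u) ^ (∑ j, x j) := by
    rw [uPow, ← Finset.prod_pow_eq_pow_sum]
    exact Ideal.prod_mem_prod fun j _ => Ideal.pow_mem_pow (Ideal.subset_span (Set.mem_range_self j)) _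
  exact Ideal.pow_le_pow_right hk this

/-- `I_𝟙(a) ⊆ (u)^⌈a⌉` — monomials of weight `|x|_𝟙 = Σ x_j ≥ a` have degree `≥ ⌈a⌉`.
[cite: CossartPiltant2019, Ch. 2 (arXiv v1 p. 9, "ord_{m_S} = μ_𝟙")] -/
theorem monomialIdeal_one_le_span_pow (u : Fin n → S) (a : ℝ) :
    monomialIdeal u (fun _ => (1 : ℝ)) a ≤ Ideal.span (Set.range u) ^ ⌈a⌉₊ := by
  apply Ideal.span_le.mpr
  rintro _ ⟨x, hx, rfl⟩
  refine uPow_mem_span_pow u ?_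
  rw [weight_one] at hx
  have : a ≤ ((∑ j, x j : ℕ) : ℝ) := by push_cast; exact hx
  exact Nat.ceil_le.mpr this

/-- `(u)ᵏ ⊆ I_𝟙(k)` — by induction on `k`, `u^x · u_j = u^{x + e_j}`.
[cite: CossartPiltant2019, Ch. 2 (arXiv v1 p. 9, "ord_{m_S} = μ_𝟙")] -/
theorem span_pow_le_monomialIdeal_one (u : Fin n → S) (k : ℕ) :
    Ideal.span (Set.range u) ^ k ≤ monomialIdeal u (fun _ => (1 : ℝ)) k := by
  induction k with
  | zero =>
    rw [pow_zero, Ideal.one_eq_top, Nat.cast_zero, monomialIdeal_of_nonpos u _ le_rfl]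
  | succ k ih =>
    rw [pow_succ]
    refine (Ideal.mul_mono_left ih).trans ?_
    rw [monomialIdeal, Ideal.span_mul_span']
    apply Ideal.span_le.mpr
    rintro _ ⟨m, ⟨x, hx, rfl⟩, v, ⟨j, rfl⟩, rfl⟩
    show uPow u x * u j ∈ monomialIdeal u (fun _ => (1 : ℝ)) ((k + 1 : ℕ) : ℝ)
    have : uPow u x * u j = uPow u (x + Pi.single j 1) := by
      rw [uPow_add, uPow_single]
    rw [this]
    refine uPow_mem_monomialIdeal u ?_
    rw [weight_add, Nat.cast_succ, weight_single]
    exact add_le_add hx le_rfl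

/-- **`I_𝟙(a) = 𝔪^⌈a⌉`** when `(u₁, …, u_n) = 𝔪` — in particular `I_𝟙(k) = 𝔪ᵏ`, i.e.
`μ_𝟙 = ord_𝔪` ("Note that `ord_{m_S} = μ_𝟙`", v1 p. 9, for an r.s.p. `u` of the local ring
`S`). [cite: CossartPiltant2019, Ch. 2 (arXiv v1 p. 9)] -/
theorem monomialIdeal_one_eq_pow {u : Fin n → S} {𝔪 : Ideal S} (hu : Ideal.span (Set.range u) = 𝔪)
    (a : ℝ) : monomialIdeal u (fun _ => (1 : ℝ)) a = 𝔪 ^ ⌈a⌉₊ := by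
  apply le_antisymm
  · exact hu ▸ monomialIdeal_one_le_span_pow u a
  · calc 𝔪 ^ ⌈a⌉₊ = Ideal.span (Set.range u) ^ ⌈a⌉₊ := by rw [hu]
      _ ≤ monomialIdeal u (fun _ => (1 : ℝ)) (⌈a⌉₊ : ℕ) := span_pow_le_monomialIdeal_one u _
      _ ≤ monomialIdeal u (fun _ => (1 : ℝ)) a := monomialIdeal_antitone u _ (Nat.le_ceil a)

/-- `I_𝟙(k) = 𝔪ᵏ` for `k ∈ ℕ`. [cite: CossartPiltant2019, Ch. 2 (arXiv v1 p. 9)] -/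
theorem monomialIdeal_one_natCast {u : Fin n → S} {𝔪 : Ideal S}
    (hu : Ideal.span (Set.range u) = 𝔪) (k : ℕ) :
    monomialIdeal u (fun _ => (1 : ℝ)) k = 𝔪 ^ k := by
  rw [monomialIdeal_one_eq_pow hu, Nat.ceil_natCast]

/-- **`δ_𝟙(h; u; X) ≥ 1 ⟺ f_{i,X} ∈ 𝔪ⁱ` for `1 ≤ i ≤ m`** when `(u) = 𝔪`. With `𝔪 = m_S`
and `Polynomial.mem_sup_span_X_sub_C_pow_natDegree_iff` (`ArithmeticalThreefoldsLocalProofs.lean`,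
`a = 0`) this is `h ∈ (m_S, X)^m`, i.e. `ord_x h = m` at `x = (m_S, X)`: the point `x` lies in
`Sing_m 𝒳` iff `δ_𝟙(h; u; X) ≥ 1` in the given coordinate `X` (cf. Prop. 2.3 (ii), v1 p. 11,
where minimal coordinates make this independent of `X`).
[cite: CossartPiltant2019, Prop. 2.3 (arXiv v1 p. 11)] -/
theorem deltaGE_one_one_iff {u : Fin n → S} {𝔪 : Ideal S} (hu : Ideal.span (Set.range u) = 𝔪)
    (h : S[X]) :
    DeltaGE u (fun _ => (1 : ℝ)) h 1 ↔
      ∀ i, 1 ≤ i → i ≤ h.natDegree → h.coeff (h.natDegree - i) ∈ 𝔪 ^ i := by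
  simp only [DeltaGE, Finset.mem_Icc, mul_one, and_imp]
  refine forall_congr' fun i => forall_congr' fun _ => forall_congr' fun _ => ?_
  rw [monomialIdeal_one_natCast hu]

/-- More generally `δ_𝟙 ≥ q ⟺ f_{i,X} ∈ 𝔪^⌈i q⌉` for all `i`. [cite: CossartPiltant2019, Def. 2.2 (arXiv v1 p. 10)] -/
theorem deltaGE_one_iff {u : Fin n → S} {𝔪 : Ideal S} (hu : Ideal.span (Set.range u) = 𝔪)
    (h : S[X]) (q : ℝ) :
    DeltaGE u (fun _ => (1 : ℝ)) h q ↔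
      ∀ i, 1 ≤ i → i ≤ h.natDegree → h.coeff (h.natDegree - i) ∈ 𝔪 ^ ⌈(i : ℝ) * q⌉₊ := by
  simp only [DeltaGE, Finset.mem_Icc, and_imp]
  refine forall_congr' fun i => forall_congr' fun _ => forall_congr' fun _ => ?_
  rw [monomialIdeal_one_eq_pow hu]


end Literature.AlgebraicGeometry.Resolution.CossartPiltant

end
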